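import Summits.CriticalPhenomena.PercolationContinuityZ3.Theorems.PercNearOneGluingNoHeavyPcintNawChainReduction
import Summits.CriticalPhenomena.PercolationContinuityZ3.Theorems.PercNearOneGluingNoHeavyPcintChordRandPairs
import HarnessLib

/-!
# PCINT lane, kind `nawchain_cw` (B2c): the payments of the window rule along a word, and their count

Cell `prim-pcint`, seat `prim-pcint-2` (gen 3); memo `run/shared/lean/prim/pcint/REDUCTIONS.md` §B2c.2–§B2c.3.
Does NOT build on p205010.

The B2c window rule seen along a whole word `γ` (memory `K`: at time `T` the incidences `i` with `T ≤ i + K`,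
`i + 2 ≤ T` are VISIBLE; chain parameter `kc`): at time `T`, a lattice neighbour `x` of `v_T` off the path is
LINKED if it has a visible incidence `i` with `T ≤ i + kc`; it then PAYS one unit, and a second one (the BONUS,
for its latest earlier incidence `i₁`) if `[i₁ - kc, i₁)` is visible (`T + kc ≤ i₁ + K`) and free of incidences.
Main results: `sum_payW_le_card_incTimes` — along the word every site pays at most its number of incidences
(REDUCTIONS §B2c.3: the paid incidences are distinct); the parity of incidence times (`incTimes_same_parity`);
and `isDetW_mem_gapSites` / the corner analysis used by the window certificate (`…PcintNawChainWindowCert`).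
-/

noncomputable section

namespace Summit.CriticalPhenomena.PercolationContinuityZ3.Theorems.Pcint

open Finset Literature.Probability.Percolation Literature.Probability.LatticeModels

variable {d n : ℕ}

/-! ### Parity of incidence times -/

/-- The coordinate sum of `v_k` has the parity of `k`. [folklore] -/
theorem coordSum_wordPos_parity (γ : Fin n → Fin d × Bool) : ∀ {k : ℕ}, k ≤ n →
    ∃ z : ℤ, coordSum (wordPos γ k) = 2 * z + k
  | 0, _ => ⟨0, by simp [coordSum]⟩
  | k + 1, hk => by
    obtain ⟨z, hz⟩ := coordSum_wordPos_parity γ (by omega : k ≤ n)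
    rcases coordSum_of_adj (zdGraph_adj_wordPos_succ γ (by omega : k < n)) with h | h
    · exact ⟨z, by rw [h, hz]; push_cast; ring⟩
    · exact ⟨z - 1, by rw [h, hz]; push_cast; ring⟩

/-- **Incidence times of one site have equal parity** (`𝕃^d` is bipartite). [folklore] -/
theorem incTimes_same_parity {γ : Fin n → Fin d × Bool} {x : Site d} {i j : ℕ} (hi : i ∈ incTimes γ x)
    (hj : j ∈ incTimes γ x) : ∃ z : ℤ, (j : ℤ) = i + 2 * z := by
  obtain ⟨hin, hai⟩ := mem_incTimes.1 hi
  obtain ⟨hjn, haj⟩ := mem_incTimes.1 hj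
  obtain ⟨zi, hzi⟩ := coordSum_wordPos_parity γ hin
  obtain ⟨zj, hzj⟩ := coordSum_wordPos_parity γ hjn
  refine ⟨((j : ℤ) - i) / 2, ?_⟩
  rcases coordSum_of_adj hai with a | a <;> rcases coordSum_of_adj haj with b | b <;> omega

/-- Two incidence times never differ by `1` or `3`. [folklore] -/
theorem incTimes_ne_add_odd {γ : Fin n → Fin d × Bool} {x : Site d} {i j : ℕ} (hi : i ∈ incTimes γ x)
    (hj : j ∈ incTimes γ x) : j ≠ i + 1 ∧ j ≠ i + 3 := by
  obtain ⟨z, hz⟩ := incTimes_same_parity hi hj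
  constructor <;> intro h <;> omega

/-! ### The word-level rule: visible incidences, linked / deterministic / bonus, payments -/

/-- Visible earlier incidences of `x` at time `T` (memory `K`): `i + 2 ≤ T ≤ i + K`. [folklore] -/
def visInc (K : ℕ) (γ : Fin n → Fin d × Bool) (T : ℕ) (x : Site d) : Finset ℕ :=
  (incTimes γ x).filter fun i => T ≤ i + K ∧ i + 2 ≤ T

/-- Membership in `visInc`. [folklore] -/
theorem mem_visInc {K : ℕ} {γ : Fin n → Fin d × Bool} {T : ℕ} {x : Site d} {i : ℕ} :
    i ∈ visInc K γ T x ↔ i ∈ incTimes γ x ∧ T ≤ i + K ∧ i + 2 ≤ T := by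
  rw [visInc, mem_filter]

/-- LINKED at time `T`: `x` is a neighbour of `v_T` off the path with a visible incidence at gap `≤ kc`. [folklore] -/
def IsLinkedW (K kc : ℕ) (γ : Fin n → Fin d × Bool) (T : ℕ) (x : Site d) : Prop :=
  (zdGraph d).Adj (wordPos γ T) x ∧ x ∉ pathSites γ ∧ ∃ i ∈ visInc K γ T x, T ≤ i + kc

/-- DETERMINISTIC evidence at time `T`: a visible incidence at gap `≥ 4`. [folklore] -/
def IsDetW (K : ℕ) (γ : Fin n → Fin d × Bool) (T : ℕ) (x : Site d) : Prop :=
  ∃ i ∈ visInc K γ T x, i + 4 ≤ T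

/-- BONUS at time `T`: the latest visible incidence `i₁` has `[i₁ - kc, i₁)` visible and free of incidences.
[folklore] -/
def IsBonusW (K kc : ℕ) (γ : Fin n → Fin d × Bool) (T : ℕ) (x : Site d) : Prop :=
  ∃ i ∈ visInc K γ T x, T + kc ≤ i + K ∧ ∀ i' ∈ visInc K γ T x, i' ≠ i → i' + kc < i

open Classical in
/-- The number of units paid by `x` at time `T`: `0` (not linked), `1` (linked), `2` (linked with bonus). [folklore] -/
def payW (K kc : ℕ) (γ : Fin n → Fin d × Bool) (T : ℕ) (x : Site d) : ℕ :=
  if IsLinkedW K kc γ T x then (if IsBonusW K kc γ T x then 2 else 1) else 0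

/-- Payments are at most `2`. [folklore] -/
theorem payW_le_two (K kc : ℕ) (γ : Fin n → Fin d × Bool) (T : ℕ) (x : Site d) : payW K kc γ T x ≤ 2 := by
  unfold payW; split_ifs <;> omega

/-- A positive payment means linked. [folklore] -/
theorem isLinkedW_of_payW_pos {K kc : ℕ} {γ : Fin n → Fin d × Bool} {T : ℕ} {x : Site d} (h : 0 < payW K kc γ T x) :
    IsLinkedW K kc γ T x := by
  unfold payW at h; split_ifs at h with h1 <;> first | exact h1 | omega

/-! ### Every site pays at most its number of incidences -/

section Count

variable (K kc : ℕ) (γ : Fin n → Fin d × Bool) (x : Site d)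

open Classical in
/-- The linked times of `x`. [folklore] -/
def linkedTimes : Finset ℕ := (range (n + 1)).filter fun T => IsLinkedW K kc γ T x

open Classical in
/-- The bonus times of `x` (linked with bonus). [folklore] -/
def bonusTimes : Finset ℕ := (linkedTimes K kc γ x).filter fun T => IsBonusW K kc γ T x

/-- The incidence paid by the bonus at time `T`: the latest visible incidence. [folklore] -/
def bonusTarget (T : ℕ) : ℕ := if h : (visInc K γ T x).Nonempty then (visInc K γ T x).max' h else 0

variable {K kc γ x}

/-- Membership in `linkedTimes`. [folklore] -/
theorem mem_linkedTimes {T : ℕ} : T ∈ linkedTimes K kc γ x ↔ T ≤ n ∧ IsLinkedW K kc γ T x := by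
  classical
  rw [linkedTimes, mem_filter, mem_range, Nat.lt_succ_iff]

/-- Membership in `bonusTimes`. [folklore] -/
theorem mem_bonusTimes {T : ℕ} : T ∈ bonusTimes K kc γ x ↔ T ≤ n ∧ IsLinkedW K kc γ T x ∧ IsBonusW K kc γ T x := by
  classical
  rw [bonusTimes, mem_filter, mem_linkedTimes, and_assoc]

/-- The bonus witness is the latest visible incidence. [folklore] -/
theorem bonusTarget_spec {T : ℕ} (hb : IsBonusW K kc γ T x) :
    bonusTarget K γ x T ∈ visInc K γ T x ∧ T + kc ≤ bonusTarget K γ x T + K ∧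
      ∀ i' ∈ visInc K γ T x, i' ≠ bonusTarget K γ x T → i' + kc < bonusTarget K γ x T := by
  obtain ⟨i, hi, hiK, hiso⟩ := hb
  have hne : (visInc K γ T x).Nonempty := ⟨i, hi⟩
  have heq : bonusTarget K γ x T = i := by
    rw [bonusTarget, dif_pos hne]
    refine le_antisymm (Finset.max'_le _ hne _ fun i' hi' => ?_) (Finset.le_max' _ i hi)
    by_cases h : i' = i
    · exact h.le
    · have := hiso i' hi' h; omega
  rw [heq]
  exact ⟨hi, hiK, hiso⟩

/-- Linked times are incidence times. [folklore] -/
theorem linkedTimes_subset_incTimes : linkedTimes K kc γ x ⊆ incTimes γ x := by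
  intro T hT
  obtain ⟨hT, hl⟩ := mem_linkedTimes.1 hT
  exact mem_incTimes.2 ⟨hT, hl.1⟩

/-- Bonus targets are incidence times. [folklore] -/
theorem bonusTarget_mem_incTimes {T : ℕ} (hT : T ∈ bonusTimes K kc γ x) : bonusTarget K γ x T ∈ incTimes γ x :=
  (mem_visInc.1 (bonusTarget_spec (mem_bonusTimes.1 hT).2.2).1).1

/-- **Bonus targets of distinct bonus times are distinct.** [folklore] -/
theorem bonusTarget_injOn : Set.InjOn (bonusTarget K γ x) ↑(bonusTimes K kc γ x) := by
  intro T hT T' hT' he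
  by_contra hne
  wlog hlt : T < T' generalizing T T'
  · exact this hT' hT he.symm (Ne.symm hne) (by omega)
  obtain ⟨hTn, hTl, hTb⟩ := mem_bonusTimes.1 (mem_coe.1 hT)
  obtain ⟨hTn', hTl', hTb'⟩ := mem_bonusTimes.1 (mem_coe.1 hT')
  have hTinc : T ∈ incTimes γ x := mem_incTimes.2 ⟨hTn, hTl.1⟩
  have hTinc' : T' ∈ incTimes γ x := mem_incTimes.2 ⟨hTn', hTl'.1⟩
  obtain ⟨hb1, -, -⟩ := bonusTarget_spec hTb
  obtain ⟨hb1', -, -⟩ := bonusTarget_spec hTb'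
  obtain ⟨-, -, h2⟩ := mem_visInc.1 hb1
  obtain ⟨hinc', hK', -⟩ := mem_visInc.1 hb1'
  -- the target of `T` is below `T`; the target of `T'` is at least `T`
  have hlt1 : bonusTarget K γ x T < T := by omega
  have hne' : (visInc K γ T' x).Nonempty := ⟨_, hb1'⟩
  by_cases hvis : T ∈ visInc K γ T' x
  · have : T ≤ bonusTarget K γ x T' := by
      rw [bonusTarget, dif_pos hne']; exact Finset.le_max' _ T hvis
    omega
  · rw [mem_visInc, not_and, not_and_or] at hvis
    rcases hvis hTinc with h | h
    · -- `T` is no longer visible at `T'`: the target of `T'` is later than `T`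
      omega
    · -- `T' = T + 1`: impossible by parity
      have := (incTimes_ne_add_odd hTinc hTinc').1
      omega

/-- **A bonus target is never a linked time** (its `kc`-past is free of incidences, so it was not linked). [folklore] -/
theorem bonusTarget_not_mem_linkedTimes {T' : ℕ} (hT' : T' ∈ bonusTimes K kc γ x) :
    bonusTarget K γ x T' ∉ linkedTimes K kc γ x := by
  intro hT
  set T := bonusTarget K γ x T' with hTdef
  obtain ⟨hb1, hbK, hiso⟩ := bonusTarget_spec (mem_bonusTimes.1 hT').2.2
  obtain ⟨-, -, hT2⟩ := mem_visInc.1 hb1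
  obtain ⟨-, hl⟩ := mem_linkedTimes.1 hT
  obtain ⟨-, -, i0, hi0, hi0kc⟩ := hl
  obtain ⟨hi0inc, hi0K, hi02⟩ := mem_visInc.1 hi0
  have hi0vis : i0 ∈ visInc K γ T' x := mem_visInc.2 ⟨hi0inc, by omega, by omega⟩
  have hne : i0 ≠ T := by omega
  have := hiso i0 hi0vis hne
  omega

/-- **Each site pays at most its number of incidences** (REDUCTIONS §B2c.3). [folklore] -/
theorem sum_payW_le_card_incTimes (K kc : ℕ) (γ : Fin n → Fin d × Bool) (x : Site d) :
    ∑ T ∈ range (n + 1), payW K kc γ T x ≤ (incTimes γ x).card := by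
  classical
  set L := linkedTimes K kc γ x with hL
  set B := bonusTimes K kc γ x with hB
  have hLsub : L ⊆ range (n + 1) := fun T hT => mem_range.2 (by have := (mem_linkedTimes.1 hT).1; omega)
  have hBsub : B ⊆ range (n + 1) := fun T hT => mem_range.2 (by have := (mem_bonusTimes.1 hT).1; omega)
  have hsum : ∑ T ∈ range (n + 1), payW K kc γ T x = L.card + B.card := by
    have h1 : ∀ T ∈ range (n + 1), payW K kc γ T x = (if T ∈ L then 1 else 0) + (if T ∈ B then 1 else 0) := by
      intro T hT
      have hTn : T ≤ n := by have := mem_range.1 hT; omega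
      by_cases hl : IsLinkedW K kc γ T x <;> by_cases hb : IsBonusW K kc γ T x <;>
        simp [payW, hL, hB, mem_linkedTimes, mem_bonusTimes, hl, hb, hTn]
    rw [sum_congr rfl h1, sum_add_distrib, sum_ite_mem, sum_ite_mem, inter_eq_right.2 hLsub,
      inter_eq_right.2 hBsub, sum_const, sum_const, smul_eq_mul, smul_eq_mul, mul_one, mul_one]
  rw [hsum]
  have hdisj : Disjoint L (B.image (bonusTarget K γ x)) := by
    rw [disjoint_right]
    intro T hT
    obtain ⟨T', hT', rfl⟩ := mem_image.1 hT
    exact bonusTarget_not_mem_linkedTimes hT'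
  calc L.card + B.card = L.card + (B.image (bonusTarget K γ x)).card := by
        rw [card_image_of_injOn bonusTarget_injOn]
    _ = (L ∪ B.image (bonusTarget K γ x)).card := (card_union_of_disjoint hdisj).symm
    _ ≤ (incTimes γ x).card := card_le_card (union_subset linkedTimes_subset_incTimes fun T hT => by
        obtain ⟨T', hT', rfl⟩ := mem_image.1 hT
        exact bonusTarget_mem_incTimes hT')

end Count

/-! ### Deterministic evidence: gap sites; the corner case -/

/-- A site with deterministic evidence, linked at time `T ≤ n`, is a gap site. [folklore] -/
theorem isDetW_mem_gapSites {K kc : ℕ} {γ : Fin n → Fin d × Bool} {T : ℕ} {x : Site d} (hT : T ≤ n)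
    (hl : IsLinkedW K kc γ T x) (hd : IsDetW K γ T x) : x ∈ gapSites γ := by
  obtain ⟨hadj, hoff, -⟩ := hl
  obtain ⟨i, hi, hi4⟩ := hd
  obtain ⟨hinc, -, -⟩ := mem_visInc.1 hi
  exact mem_gapSites.2 ⟨T, hT, mem_gapSet.2 ⟨hadj, hoff, i, by omega, (mem_incTimes.1 hinc).2⟩⟩

/-- **No deterministic evidence ⇒ the only visible incidence is `T - 2`** (parity excludes `T - 3`). [folklore] -/
theorem eq_sub_two_of_not_isDetW {K kc : ℕ} {γ : Fin n → Fin d × Bool} {T : ℕ} {x : Site d} (hT : T ≤ n)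
    (hl : IsLinkedW K kc γ T x) (hd : ¬ IsDetW K γ T x) {i : ℕ} (hi : i ∈ visInc K γ T x) : i + 2 = T := by
  obtain ⟨hinc, -, hi2⟩ := mem_visInc.1 hi
  have h4 : ¬ (i + 4 ≤ T) := fun h => hd ⟨i, hi, h⟩
  have hTinc : T ∈ incTimes γ x := mem_incTimes.2 ⟨hT, hl.1⟩
  have := (incTimes_ne_add_odd hinc hTinc).2
  omega

/-- Without deterministic evidence, an old (invisible or visible) incidence `i + 3 ≤ T` makes `x` a gap site;
contrapositive form used for corner-only corners. [folklore] -/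
theorem not_adj_of_not_mem_gapSites {K kc : ℕ} {γ : Fin n → Fin d × Bool} {T : ℕ} {x : Site d} (hT : T ≤ n)
    (hl : IsLinkedW K kc γ T x) (hx : x ∉ gapSites γ) {i : ℕ} (hi : i + 3 ≤ T) :
    ¬ (zdGraph d).Adj (wordPos γ i) x := fun hadj =>
  hx (mem_gapSites.2 ⟨T, hT, mem_gapSet.2 ⟨hl.1, hl.2.1, i, hi, hadj⟩⟩)

end Summit.CriticalPhenomena.PercolationContinuityZ3.Theorems.Pcint
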